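import Summits.BirchSwinnertonDyer.Rank1Residual.Additive.TameBranchTeichmuller
import Literature.NumberTheory.EllipticCurves.CyclotomicInterpolantUniquenessProofs
import HarnessLib

/-!
# Class N10, tame branch: the E-normalised tame branch is UNIQUE — a bounded witness of
# `IsTameBranchOf f p ε α B` is determined by the tuple `(f, ε, α)` (the ROBUSTNESS paragraph of
# `TameBranchLower.lean` as a theorem; cell `b2b-bsdres`, lane CLASS-CLOSURE, seat cc-typer-2 GEN 3)

HONEST FRAMING (cell `b2b-bsdres`, run/shared/lean/b2b/bsd-rank1-residual/, verbatim in every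
file): the goal of the cell is to DELETE the COMBINATION-SHAPED residual classes of the
Birch–Swinnerton-Dyer formula for ALL analytic-rank `≤ 1` elliptic curves over `ℚ` — "full BSD
formula for every rank `≤ 1` curve in class `C`" assembled STRICTLY from published theorems — so
that the rank-`≤ 1` remainder becomes exactly the CONSTRUCTION-SHAPED classes, which are TYPED
(missing-input `Prop`s), NOT attempted. This is not "finishing BSD". Lane CLASS-CLOSURE
(coordinator ruling 2026-08-21T04:07Z): research routes, no claim beyond the stated classes;
census output = EVIDENCE / conjecture items with held-out validation, NEVER a Literature fact;
the class N10 stays CONSTRUCTION-shaped (RESIDUAL-MAP §I); NOTHING is booked. THEOREMS ONLY; no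
definition, no named fact, no conjecture node; labels / RESIDUAL-MAP marks UNCHANGED.

## What and why

`IsTameBranchOf f p ε α B` (`TameBranchLower.lean` §1) types the E-normalised `ε̄`-branch of the
additive curve's cyclotomic analytic object by INTERPOLATION: `B ∈ ℚ_p⟦T⟧` bounded,
`B(0) = α⁻¹[0]⁺_f`, and `B(κ(γ) − 1) = α^{−m} p^{−1} τ(ε,ψ_κ) ∑_b κ(b)[b/p^m]⁺_f` for every
primitive even `p`-power-order `κ` of conductor `p^m`, `m ≥ 2`. The typed main conjecture
`TameBranchRatCharEqAt W p` quantifies over EVERY such witness `B`, and the LOWER chain's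
unit-coefficient certificate (`TameBranchCensusJoin.lean`) is asked "for every tuple". The docstring
of §2 (ROBUSTNESS) asserts informally that a bounded witness is unique. THIS FILE PROVES IT:

* `not_isPrimitive_of_orderOf_eq_pow_level_one` — there is NO primitive Dirichlet character of
  conductor `p` of `p`-power order (its order divides `φ(p) = p − 1`), so the conductor-`p` row that
  `IsTameBranchOf` omits (only `m ≥ 2` is prescribed; `κ = 1` is the constant term) carries no
  information: the characters of `Γ` have conductor `1` or `≥ p²`;
* `IsTameBranchOf.unique` — **two bounded witnesses for the same `(f, ε, α)` are EQUAL**: their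
  difference is bounded, has constant term `0` and vanishes at `κ(γ) − 1` for every character `κ` of
  `Γ`, hence is `0` by the tree's uniqueness principle for bounded cyclotomic interpolants
  `eq_zero_of_bounded_of_forall_character_hasSum_zero` (`CyclotomicInterpolantUniquenessProofs`;
  Mazur–Tate–Teitelbaum 1986 §I.11: `p`-adic `L`-functions of ordinary forms are Mellin transforms of
  MEASURES, i.e. bounded — boundedness cannot be dropped, `log(1+T)` vanishes at every `ζ − 1`);
* consequences: `existsUnique` repackaging; every coefficient, the unit-coefficient certificate
  `∃ n, ‖[Tⁿ]B‖ = 1` and integrality `∀ n, ‖[Tⁿ]B‖ ≤ 1` are INVARIANTS of `(f, ε, α)` — so the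
  per-pair certificate of the LOWER chain may be read off ANY witness (e.g. the Mellin transform of
  the census symbol, `exists_isTameBranchOf_of_hasOrdinaryTwistPartner`), and on the census locus
  X4-3 the bridge's integrality transfer holds for EVERY witness with the bridge's `ã`
  (`IsTameBranchOf.norm_coeff_le_of_hasOrdinaryTwistPartner`).

What is NOT proved here (and not claimed): uniqueness of the unit `α` (for a wrong unit the
prescribed values differ from `B_E`'s by `(α/α')^m`; the docstring's "vacuous rows" remark stays
informal), and dependence on `ε` versus `ε̄`.

References: Mazur–Tate–Teitelbaum, Invent. Math. 84 (1986) §I.11, §I.14 (14.3)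
[MazurTateTeitelbaum1986Invent]; HOME/class-closure/N10/STATEMENT.md; `TameBranchLower.lean` §2
ROBUSTNESS.
-/

noncomputable section

open scoped Classical MatrixGroups ModularForm

open CongruenceSubgroup

namespace Summit.BirchSwinnertonDyer.Rank1Residual.Additive

open Literature.NumberTheory.EllipticCurves Literature.NumberTheory.EllipticCurves.ModularForms

/-! ### §1 No character of `Γ` has conductor exactly `p` -/

section LevelOne

variable {p : ℕ} [hp : Fact p.Prime]

/-- A multiplicative character of `ℤ/n` (`n ≠ 0`) is killed by `φ(n)`: `χ^{φ(n)} = 1`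
(Euler: `a^{φ(n)} = 1` for every unit `a`). [folklore] -/
theorem mulChar_pow_totient_eq_one {R : Type*} [CommMonoidWithZero R] {n : ℕ} [NeZero n]
    (χ : MulChar (ZMod n) R) : χ ^ Nat.totient n = 1 := by
  refine MulChar.ext fun a ↦ ?_
  rw [MulChar.pow_apply_coe, ← map_pow, ← Units.val_pow_eq_pow_val, ZMod.pow_totient,
    Units.val_one, map_one, MulChar.one_apply_coe]

/-- Hence the order of a character of `ℤ/n` divides `φ(n)`. [folklore] -/
theorem mulChar_orderOf_dvd_totient {R : Type*} [CommMonoidWithZero R] {n : ℕ} [NeZero n]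
    (χ : MulChar (ZMod n) R) : orderOf χ ∣ Nat.totient n :=
  orderOf_dvd_of_pow_eq_one (mulChar_pow_totient_eq_one χ)

/-- **There is no primitive Dirichlet character of conductor `p` of `p`-power order**: its order
divides `φ(p) = p − 1`, which is prime to `p`, so the character is trivial, of conductor `1 ≠ p`.
(The characters of `Γ = 1 + pℤ_p` — even, of `p`-power order — have conductor `1` or `≥ p²`; this is
why `IsTameBranchOf` prescribes the rows `m ≥ 2` and the constant term only.) [folklore] -/
theorem not_isPrimitive_of_orderOf_eq_pow_level_one {R : Type*} [CommMonoidWithZero R]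
    {χ : DirichletCharacter R (p ^ 1)} (hord : ∃ j : ℕ, orderOf χ = p ^ j) : ¬ χ.IsPrimitive := by
  haveI : NeZero (p ^ 1) := ⟨pow_ne_zero _ hp.out.ne_zero⟩
  obtain ⟨j, hj⟩ := hord
  have hdvd : p ^ j ∣ p - 1 := by
    have h := mulChar_orderOf_dvd_totient χ
    rwa [hj, pow_one, Nat.totient_prime hp.out] at h
  have hj0 : j = 0 := by
    by_contra hj0
    have hpd : p ∣ p - 1 := (dvd_pow_self p hj0).trans hdvd
    have hle := Nat.le_of_dvd (Nat.sub_pos_of_lt hp.out.one_lt) hpd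
    have h2 := hp.out.two_le
    omega
  rw [hj0, pow_zero, orderOf_eq_one_iff] at hj
  intro hprim
  rw [DirichletCharacter.isPrimitive_def, hj, DirichletCharacter.conductor_one, pow_one] at hprim
  exact hp.out.one_lt.ne hprim

end LevelOne

/-! ### §2 Uniqueness of the bounded E-normalised tame branch -/

section Unique

variable {p : ℕ} [hp : Fact p.Prime] {N : ℕ} {f : CuspForm (Gamma0 N) 2}
  {ε : DirichletCharacter ℂ_[p] p} {α : ℚ_[p]} {B B' : PowerSeries ℚ_[p]}

/-- **UNIQUENESS of the E-normalised tame branch** (the ROBUSTNESS paragraph of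
`TameBranchRatCharEqAt` as a theorem): if `B` and `B'` both satisfy the interpolation package
`IsTameBranchOf f p ε α` (same newform symbol, same tame character, same unit), then `B = B'`.
Both are bounded (part of the package), they have the same constant term `α⁻¹[0]⁺_f` and the same
value at `κ(γ) − 1` for every primitive even `p`-power-order `κ` of conductor `p^m`, `m ≥ 2`; there
is no such `κ` of conductor `p` (`not_isPrimitive_of_orderOf_eq_pow_level_one`); so `B − B'` is a
bounded series vanishing at the constant term and at every character of `Γ`, and the tree's
uniqueness principle for bounded cyclotomic interpolants
(`eq_zero_of_bounded_of_forall_character_hasSum_zero`, along `ℚ_p ↪ ℂ_p`) gives `B − B' = 0`.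
Boundedness is essential (`log(1+T)`). [cite: MazurTateTeitelbaum1986Invent, §I.11 and §I.14 (14.3)] -/
theorem IsTameBranchOf.unique (h : IsTameBranchOf f p ε α B) (h' : IsTameBranchOf f p ε α B') :
    B = B' := by
  obtain ⟨C, hC⟩ := h.bounded
  obtain ⟨C', hC'⟩ := h'.bounded
  rw [← sub_eq_zero]
  refine eq_zero_of_bounded_of_forall_character_hasSum_zero (algebraMap ℚ_[p] ℂ_[p])
    (algebraMap ℚ_[p] ℂ_[p]).injective (C := C + C') (fun i ↦ ?_) ?_ ?_
  · rw [norm_algebraMap', map_sub]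
    exact (norm_sub_le _ _).trans (add_le_add (hC i) (hC' i))
  · rw [map_sub, h.constantCoeff, h'.constantCoeff, sub_self]
  · intro m hm κ hκ heven hord
    rcases Nat.lt_or_ge m 2 with hm2 | hm2
    · obtain rfl : m = 1 := by omega
      exact absurd hκ (not_isPrimitive_of_orderOf_eq_pow_level_one hord)
    · have hs := (h.2.2 m hm2 κ hκ heven hord).sub (h'.2.2 m hm2 κ hκ heven hord)
      rw [sub_self] at hs
      refine hs.congr_fun fun i ↦ ?_
      rw [map_sub, map_sub, sub_mul]

/-- `∃!` form: as soon as SOME bounded E-normalised tame branch exists for `(f, ε, α)` (e.g. by the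
bridge `exists_isTameBranchOf_of_hasOrdinaryTwistPartner` on the census locus, or by
Mazur–Tate–Teitelbaum §I for the true tuple — the named prerequisite of `TameBranchLower.lean`),
there is EXACTLY ONE. [cite: MazurTateTeitelbaum1986Invent, §I.11 and §I.14 (14.3)] -/
theorem existsUnique_isTameBranchOf_of_exists (h : ∃ B, IsTameBranchOf f p ε α B) :
    ∃! B, IsTameBranchOf f p ε α B := by
  obtain ⟨B, hB⟩ := h
  exact ⟨B, hB, fun B' hB' ↦ hB'.unique hB⟩

/-- Every coefficient of the E-normalised tame branch is an invariant of `(f, ε, α)`. [folklore] -/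
theorem IsTameBranchOf.coeff_eq (h : IsTameBranchOf f p ε α B) (h' : IsTameBranchOf f p ε α B')
    (n : ℕ) : PowerSeries.coeff n B = PowerSeries.coeff n B' := by
  rw [h.unique h']

/-- **The unit-coefficient certificate is witness-free**: "some coefficient of the E-normalised
branch is a `p`-adic unit" (the finite certificate `hcert` of the LOWER chain
`cycLeadingTermDvdAt_of_tameBranchRatCharEq_of_unitCoeff`, forcing the exponent `k ≥ 0`) holds for
one witness iff it holds for any other. So the per-pair certificate may be read off ANY witness —
in particular off the Mellin transform of the census symbol `Φ` (ENG-D Riemann sums) — and then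
serves the `∀ (ã, B)`-quantified hypothesis of `cycLeadingTermDvdAt_of_tameBranchRatCharEq_of_ordinaryTwistPartnerAt`
for that `ã`. [folklore] -/
theorem IsTameBranchOf.exists_norm_coeff_eq_one_iff (h : IsTameBranchOf f p ε α B)
    (h' : IsTameBranchOf f p ε α B') :
    (∃ n : ℕ, ‖PowerSeries.coeff n B‖ = 1) ↔ ∃ n : ℕ, ‖PowerSeries.coeff n B'‖ = 1 := by
  rw [h.unique h']

/-- **Integrality is witness-free**: a coefficient bound `‖[Tⁿ]B‖ ≤ C` for one witness is the same
statement for any other (the `hint` binder of the UPPER chain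
`cycLeadingTermAt_of_tameBranchRatCharEq_of_hasUnitContent_of_integral`). [folklore] -/
theorem IsTameBranchOf.norm_coeff_le_iff (h : IsTameBranchOf f p ε α B)
    (h' : IsTameBranchOf f p ε α B') (C : ℝ) :
    (∀ n : ℕ, ‖PowerSeries.coeff n B‖ ≤ C) ↔ ∀ n : ℕ, ‖PowerSeries.coeff n B'‖ ≤ C := by
  rw [h.unique h']

/-- **On an ordinary twist partner's character, EVERY witness with the bridge's unit inherits the
integrality transfer.** If `[·]⁺_f` has an ordinary twist partner for `χ ≠ 1`
(`CensusX43.HasOrdinaryTwistPartner χ f`), the bridge produces `ã`, `‖ã‖ = 1`, and a witness `B₀`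
with `‖[Tⁿ]B₀‖ ≤ C` for every bound `C` of the plus symbols; by uniqueness ANY `B` with
`IsTameBranchOf f p (ι∘χ) ã B` IS `B₀`, so the transfer `(∀ r, ‖[r]⁺_f‖ ≤ C) → ∀ n, ‖[Tⁿ]B‖ ≤ C`
holds for it. (Pure bookkeeping over `exists_isTameBranchOf_of_hasOrdinaryTwistPartner`.) [folklore] -/
theorem exists_unit_forall_isTameBranchOf_norm_coeff_le_of_hasOrdinaryTwistPartner
    {χ : MulChar (ZMod p) ℚ_[p]} (hχ : χ ≠ 1) (hΦ : CensusX43.HasOrdinaryTwistPartner χ f) :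
    ∃ ã : ℚ_[p], ‖ã‖ = 1 ∧ (∃ B, IsTameBranchOf f p (χ.ringHomComp (algebraMap ℚ_[p] ℂ_[p])) ã B) ∧
      ∀ B, IsTameBranchOf f p (χ.ringHomComp (algebraMap ℚ_[p] ℂ_[p])) ã B →
        ∀ C : ℝ, (∀ r : ℚ, ‖((ratPlusSymbol f r : ℚ) : ℚ_[p])‖ ≤ C) →
          ∀ n : ℕ, ‖PowerSeries.coeff n B‖ ≤ C := by
  obtain ⟨ã, B₀, hã, hB₀, hint⟩ := exists_isTameBranchOf_of_hasOrdinaryTwistPartner hχ hΦ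
  refine ⟨ã, hã, ⟨B₀, hB₀⟩, fun B hB C hC n ↦ ?_⟩
  rw [hB.unique hB₀]
  exact hint C hC n

end Unique

/-! ### §3 On the census locus X4-3: the tame branch delivered by the census input is THE tame branch -/

section Locus

variable (W : WeierstrassCurve ℚ) [W.IsElliptic] [W.IsGloballyMinimal] (p : ℕ) [hp : Fact p.Prime]

/-- **X4-3 locus, `∃!` form of the bridge.** On cell (G-ord) with defect `e ∈ {3,4,6}` at `p ≥ 5`,
the census's typed input `CensusX43.OrdinaryTwistPartnerAt W p` delivers, for the newform `f` of `E`
and `χ = ω^{t(E,p)}`, a unit `ã` and a UNIQUE E-normalised tame branch `B` for the tuple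
`(f, ι∘χ, ã)` — with `orderOf (ι∘χ) = tameDefect E p` and the integrality transfer for that `B`.
So on X4-3 rows "the" tame branch of the typed main conjecture `TameBranchRatCharEqAt W p` is a
well-defined power series attached to the census datum, not a free witness. Nothing booked.
[folklore] -/
theorem exists_unit_existsUnique_isTameBranchOf_of_ordinaryTwistPartnerAt (h5 : 5 ≤ p)
    (hG : SubGord W p) (he : semistabilityIndex W p ∈ ({3, 4, 6} : Finset ℕ))
    (h : CensusX43.OrdinaryTwistPartnerAt W p) {N : ℕ} [NeZero N] {f : CuspForm (Gamma0 N) 2}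
    (hf : IsNewformOf W f) {χ : MulChar (ZMod p) ℚ_[p]}
    (hχ : CensusX43.IsTeichmullerPow χ (CensusX43.ordinaryTeichmullerExponent W p)) :
    ∃ ã : ℚ_[p], ‖ã‖ = 1 ∧
      orderOf (χ.ringHomComp (algebraMap ℚ_[p] ℂ_[p])) = tameDefect W p ∧
      (∃! B, IsTameBranchOf f p (χ.ringHomComp (algebraMap ℚ_[p] ℂ_[p])) ã B) ∧
      ∀ B, IsTameBranchOf f p (χ.ringHomComp (algebraMap ℚ_[p] ℂ_[p])) ã B →
        ∀ C : ℝ, (∀ r : ℚ, ‖((ratPlusSymbol f r : ℚ) : ℚ_[p])‖ ≤ C) →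
          ∀ n : ℕ, ‖PowerSeries.coeff n B‖ ≤ C := by
  obtain ⟨ã, B₀, hã, hord, hB₀, hint⟩ :=
    exists_isTameBranchOf_of_ordinaryTwistPartnerAt W p h5 hG he h hf hχ
  refine ⟨ã, hã, hord, ⟨B₀, hB₀, fun B hB ↦ hB.unique hB₀⟩, fun B hB C hC n ↦ ?_⟩
  rw [hB.unique hB₀]
  exact hint C hC n

end Locus

end Summit.BirchSwinnertonDyer.Rank1Residual.Additive

end
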